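import Literature.MathematicalPhysics.QuantumFieldTheory.Balaban1983to89.B3CxiTadpole
import Mathlib.Analysis.SpecialFunctions.Pow.Integral
import Mathlib.Analysis.SpecialFunctions.Pow.Asymptotics

/-!
# `Balaban1983to89.B3CxiTadpoleLimit` — T. Bałaban, *(Higgs)₂,₃ quantum fields in a finite volume. III. Renormalization*,
Commun. Math. Phys. **88** (1983) 411–445 [Balaban1983Higgs3], p. 438 [PDF 28]: **"ηG_k(x,x) is convergent to some finite constant
as η → 0"** — PROVED for the free propagator `C^ξ = (−Δ^ξ + 1)^{−1}` on `ξℤ^d` to which Sect. 3 reduces its propagators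
((3.16), (3.23)–(3.24), (3.27)–(3.29)): `ξ·C^ξ(0) → (2π)^{−3}∫_{[−π,π]³} dq/Δ¹(q)` as `ξ → 0⁺` in `d = 3`, and `ξ·C^ξ(0) → 0` in `d = 2`

statement-level skeleton of published theorems with citation tags; proofs where landed; nothing here is a claim about the Yang–Mills mass gap

PDF held: `paper:balaban1983-higgs-2-3-quantum-fields-finite-volume` (journal page = PDF page + 410); p. 438 read in the OCR text
`p0028.txt` and on the render `run/shared/lean/pub/pub-balaban/b2b-balaban-ref1/pages/1983-cmp88-higgs23-III/1983-cmp88-higgs23-III-p028-x4.png`.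

CITATION HEADER (lean-in-tree rule).  Part of the lit-balaban TYPED SKELETON (HOME `run/shared/lean/pub/lit-balaban/`), PHASE 2, seat p20
generation 4.  WHAT IS REPRODUCED: row **B3.Eq3.21-3.24** of `HOME/lit-balaban-r15/ROWS-B3.md` (fold owner r15) — the p. 438 sentence on
the first graph of (3.21).  Inputs: r15 g4's `B3CxiTadpole` (p250728: the rescaled tadpole `Cxi_zero_eq`, Jordan's bound
`norm_sq_le_lapSymbol`, the bounds `Cxi_zero_le_three`, `Cxi_zero_le_two_log`), r15's `B3CxiPropagator.Cxi_nonneg` (p249410) and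
`B3Sect3VectorSelfEnergy.Cxi`/`lapSymbol`/`bzBox` (p245939); Mathlib's `integrableOn_ball_of_norm_le_rpow` (polar coordinates) and the
dominated convergence theorem.

THE PRINTED TEXT (verbatim, p. 438).  *"We have to consider another class of graphs with two external scalar field legs, the graphs with
one leg differentiated. There are only two such graphs: (3.21). The expression corresponding to the first graph is in fact convergent,
because ηG_k(x,x) is convergent to some finite constant as η → 0."*

WHAT IS PROVED, and how.  The sentence is made a theorem for the FREE covariance of Sect. 3 (the propagator `C^ξ` by which `G_{j″}(0)`,
`G_{j₀}(0)` are replaced on pp. 437, 439, 441 "in the way described several times"; by (2.10) each piece `G^η_{(j)}(x,x)` is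
`O((L^jη)^{−d+2})`, so in `d = 3` the scale-`ξ` tadpole is the quantity `ξ·C^ξ(0)`):
* `xi_mul_Cxi_zero_eq` — `ξ·C^ξ(0) = (2π)^{−3}∫_{|q_μ|≤π} dq/(Δ¹(q) + ξ²)` (`d = 3`; r15's `Cxi_zero_eq` times `ξ`);
* `integrableOn_inv_lapSymbol` — `1/Δ¹` is integrable on the Brillouin box in `d = 3` (Jordan `Δ¹(q) ≥ (4/π²)‖q‖²_∞`, so `1/Δ¹ ≤
  (π²/4)‖q‖^{−2}`, integrable on balls of `ℝ³` — Mathlib `integrableOn_ball_of_norm_le_rpow`; the box is the closed sup-norm ball of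
  radius `π`, its boundary sphere is Lebesgue-null);
* **`tendsto_xi_mul_Cxi_zero_three`** — `ξ·C^ξ(0) → K₃ := (2π)^{−3}∫_{|q_μ|≤π} dq/Δ¹(q)` as `ξ → 0⁺` (dominated convergence, majorant
  `1/Δ¹`); `exists_tendsto_xi_mul_Cxi_zero_three` (the printed shape: convergent to SOME finite constant); `tadpoleConst_mem_Icc` —
  `1/12 ≤ K₃ ≤ 3(π+1)/(4π)` (so the constant is finite and NONZERO);
* `tendsto_xi_mul_Cxi_zero_two` — in `d = 2`, `ξ·C^ξ(0) → 0` (the finite constant is `0`: `0 ≤ C^ξ(0) ≤ A + ½log ξ^{−1}` and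
  `ξ log ξ^{−1} → 0`).
NOT claimed: the statement for the full propagator `G_k(Ω, B̃; x, x)` (it needs the kernel bounds (2.10), rows B3.Eq2.10–2.12 =
[Balaban1982Higgs1] Props. 2.1/2.3), the value of `K₃` in closed form, rates.  D-0026: theorems only, no `def`, no named fact; standard
axioms.  Unit `lit-balaban-p20` (literature-prover-lit-balaban-p20-g4-0), 2026-08-21.
-/

open MeasureTheory Filter Set Metric
open scoped Topology

namespace Literature.MathematicalPhysics.QuantumFieldTheory.Balaban1983to89.B3CxiTadpoleLimit

open B3Sect3VectorSelfEnergy B3CxiPropagator B3CxiTadpole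
open _root_.MeasureTheory _root_.Filter _root_.Set _root_.Metric

noncomputable section

/-! ## 1. The symbol Δ¹: continuity, the Jordan majorant of 1/Δ¹, the box as a closed sup-norm ball -/

section Symbol

variable {d : ℕ}

/-- The symbol `Δ^ξ(p)` is continuous. [cite: Balaban1983Higgs3, (3.28) p.441] -/
theorem continuous_lapSymbol (d : ℕ) (ξ : ℝ) : Continuous (lapSymbol d ξ) := by
  unfold lapSymbol
  fun_prop

/-- The symbol `Δ^ξ(p)` is measurable. [cite: Balaban1983Higgs3, (3.28) p.441] -/
theorem measurable_lapSymbol (d : ℕ) (ξ : ℝ) : Measurable (lapSymbol d ξ) :=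
  (continuous_lapSymbol d ξ).measurable

/-- On the Brillouin box `|q_μ| ≤ π` the inverse symbol is majorised by the Riesz kernel: `1/Δ¹(q) ≤ (π²/4)‖q‖^{−2}` (`‖·‖` the sup
norm; Jordan's inequality `B3CxiTadpole.norm_sq_le_lapSymbol`; at `q = 0` both sides vanish). [cite: Balaban1983Higgs3, (3.21) p.438] -/
theorem inv_lapSymbol_le {q : Fin d → ℝ} (hq : q ∈ bzBox d 1) :
    (lapSymbol d 1 q)⁻¹ ≤ Real.pi ^ 2 / 4 * ‖q‖ ^ (-(2 : ℝ)) := by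
  by_cases h0 : q = 0
  · subst h0
    have hL : lapSymbol d 1 0 = 0 := by simp [lapSymbol]
    rw [hL, inv_zero, norm_zero, Real.zero_rpow (by norm_num), mul_zero]
  · have hn : 0 < ‖q‖ := norm_pos_iff.mpr h0
    have hJ := norm_sq_le_lapSymbol hq
    have hpos : 0 < 4 / Real.pi ^ 2 * ‖q‖ ^ 2 := by positivity
    calc (lapSymbol d 1 q)⁻¹ ≤ (4 / Real.pi ^ 2 * ‖q‖ ^ 2)⁻¹ := inv_anti₀ hpos hJ
      _ = Real.pi ^ 2 / 4 * ‖q‖ ^ (-(2 : ℝ)) := by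
          rw [Real.rpow_neg hn.le, Real.rpow_two]
          field_simp

/-- Off the origin the symbol is positive on the box. [cite: Balaban1983Higgs3, (3.21) p.438] -/
theorem lapSymbol_pos {q : Fin d → ℝ} (hq : q ∈ bzBox d 1) (h0 : q ≠ 0) : 0 < lapSymbol d 1 q :=
  lt_of_lt_of_le (by have := norm_pos_iff.mpr h0; positivity) (norm_sq_le_lapSymbol hq)

/-- The open sup-norm ball of radius `π` lies in the Brillouin box. [cite: Balaban1983Higgs3, (3.28) p.441] -/
theorem ball_subset_bzBox : ball (0 : Fin d → ℝ) Real.pi ⊆ bzBox d 1 := by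
  intro q hq μ
  rw [div_one]
  rw [mem_ball_zero_iff] at hq
  exact ((Real.norm_eq_abs (q μ)).symm.le.trans (norm_le_pi_norm q μ)).trans hq.le

/-- The Brillouin box lies in the closed sup-norm ball of radius `π`. [cite: Balaban1983Higgs3, (3.28) p.441] -/
theorem bzBox_subset_closedBall : bzBox d 1 ⊆ closedBall (0 : Fin d → ℝ) Real.pi := by
  intro q hq
  rw [mem_closedBall_zero_iff, pi_norm_le_iff_of_nonneg Real.pi_pos.le]
  intro μ
  rw [Real.norm_eq_abs]
  simpa using hq μ

/-- The Brillouin box is a measurable set (it is closed). [cite: Balaban1983Higgs3, (3.28) p.441] -/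
theorem measurableSet_bzBox (d : ℕ) (ξ : ℝ) : MeasurableSet (bzBox d ξ) := by
  have h : bzBox d ξ = ⋂ μ : Fin d, (fun p : Fin d → ℝ => |p μ|) ⁻¹' Iic (Real.pi / ξ) := by
    ext p; simp [bzBox]
  rw [h]
  exact MeasurableSet.iInter fun μ => (continuous_apply μ).abs.measurable measurableSet_Iic

/-- The Brillouin box `|q_μ| ≤ π` is the order interval `[−π, π]^d` of `ℝ^d`. [cite: Balaban1983Higgs3, (3.28) p.441] -/
theorem bzBox_one_eq_Icc (d : ℕ) : bzBox d 1 = Icc (fun _ : Fin d => -Real.pi) (fun _ => Real.pi) := by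
  ext q
  simp only [bzBox, div_one, mem_setOf_eq, mem_Icc, Pi.le_def, abs_le, forall_and]

/-- The Lebesgue measure of the Brillouin box is `(2π)^d`. [cite: Balaban1983Higgs3, (3.28) p.441] -/
theorem volume_bzBox_one (d : ℕ) : volume (bzBox d 1) = ENNReal.ofReal (2 * Real.pi) ^ d := by
  rw [bzBox_one_eq_Icc, Real.volume_Icc_pi]
  simp only [sub_neg_eq_add, Finset.prod_const, Finset.card_univ, Fintype.card_fin, two_mul]

/-- The symbol is bounded: `Δ¹(q) ≤ 4d`. [cite: Balaban1983Higgs3, (3.28) p.441] -/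
theorem lapSymbol_one_le (q : Fin d → ℝ) : lapSymbol d 1 q ≤ 4 * d := by
  rw [lapSymbol_one_apply]
  calc ∑ μ : Fin d, (2 - 2 * Real.cos (q μ)) ≤ ∑ _μ : Fin d, (4 : ℝ) :=
        Finset.sum_le_sum fun μ _ => by linarith [Real.neg_one_le_cos (q μ)]
    _ = 4 * d := by rw [Finset.sum_const, Finset.card_univ, Fintype.card_fin, nsmul_eq_mul]; ring

end Symbol

/-! ## 2. d = 3: integrability of 1/Δ¹ on the box and the rescaled tadpole -/

section Three

/-- **`1/Δ¹` is integrable on the Brillouin box in `d = 3`** (polar coordinates: `1/Δ¹ ≤ (π²/4)‖q‖^{−2}` and `2 < 3`; the boundary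
sphere of the box is Lebesgue-null). [cite: Balaban1983Higgs3, (3.21) p.438] -/
theorem integrableOn_inv_lapSymbol :
    IntegrableOn (fun q : Fin 3 → ℝ => (lapSymbol 3 1 q)⁻¹) (bzBox 3 1) volume := by
  have hmeas : AEStronglyMeasurable (fun q : Fin 3 → ℝ => (lapSymbol 3 1 q)⁻¹) volume :=
    (measurable_lapSymbol 3 1).inv.aestronglyMeasurable
  have hball : IntegrableOn (fun q : Fin 3 → ℝ => (lapSymbol 3 1 q)⁻¹) (ball 0 Real.pi) volume := by
    refine integrableOn_ball_of_norm_le_rpow (E := Fin 3 → ℝ) (μ := volume) (by simp) (C := Real.pi ^ 2 / 4) (α := 2)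
      (by simp; norm_num) ?_ hmeas
    refine (ae_restrict_iff' measurableSet_ball).2 (ae_of_all _ fun q hq => ?_)
    rw [Real.norm_of_nonneg (inv_nonneg.2 (lapSymbol_nonneg 3 1 q))]
    exact inv_lapSymbol_le (ball_subset_bzBox hq)
  have hsph : IntegrableOn (fun q : Fin 3 → ℝ => (lapSymbol 3 1 q)⁻¹) (sphere 0 Real.pi) volume := by
    rw [IntegrableOn, Measure.restrict_eq_zero.2 (Measure.addHaar_sphere volume (0 : Fin 3 → ℝ) Real.pi)]
    exact integrable_zero_measure
  refine (hball.union hsph).mono_set ?_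
  rw [ball_union_sphere]
  exact bzBox_subset_closedBall

/-- **The rescaled tadpole in d = 3**: `ξ·C^ξ(0) = (2π)^{−3}∫_{|q_μ|≤π} dq/(Δ¹(q) + ξ²)`, `ξ > 0` (r15's `B3CxiTadpole.Cxi_zero_eq` times
`ξ`: `ξ·ξ²·ξ^{−3} = 1`). [cite: Balaban1983Higgs3, (3.21) p.438] -/
theorem xi_mul_Cxi_zero_eq {ξ : ℝ} (hξ : 0 < ξ) :
    ξ * Cxi 3 ξ 0 = (2 * Real.pi)⁻¹ ^ 3 * ∫ q in bzBox 3 1, 1 / (lapSymbol 3 1 q + ξ ^ 2) := by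
  rw [Cxi_zero_eq (d := 3) hξ]
  have h : ξ * ((2 * Real.pi)⁻¹ ^ 3 * (ξ ^ 2 * (ξ ^ 3)⁻¹)) = (2 * Real.pi)⁻¹ ^ 3 := by
    field_simp
  rw [← mul_assoc, ← mul_assoc, mul_assoc ξ, h]

/-- kernel: the integrands `1/(Δ¹ + ξ²)` converge to `1/Δ¹` off the origin as `ξ → 0⁺`. [folklore] -/
private theorem tendsto_inv_add_sq {L : ℝ} (hL : 0 < L) :
    Tendsto (fun ξ : ℝ => 1 / (L + ξ ^ 2)) (𝓝[>] 0) (𝓝 L⁻¹) := by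
  have h : Tendsto (fun ξ : ℝ => 1 / (L + ξ ^ 2)) (𝓝 0) (𝓝 (1 / (L + 0 ^ 2))) :=
    tendsto_const_nhds.div (tendsto_const_nhds.add ((continuous_pow 2).tendsto 0)) (by positivity)
  rw [zero_pow two_ne_zero, add_zero, one_div] at h
  exact h.mono_left nhdsWithin_le_nhds

/-- kernel: almost every point of the box (Lebesgue measure restricted to the box) lies in the box and is not the origin. [folklore] -/
private theorem ae_mem_bzBox_ne_zero :
    ∀ᵐ q ∂(volume.restrict (bzBox 3 1)), q ∈ bzBox 3 1 ∧ q ≠ (0 : Fin 3 → ℝ) := by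
  have h1 : ∀ᵐ q ∂(volume.restrict (bzBox 3 1)), q ∈ bzBox 3 1 := ae_restrict_mem (measurableSet_bzBox 3 1)
  have h2 : ∀ᵐ q ∂(volume.restrict (bzBox 3 1)), q ≠ (0 : Fin 3 → ℝ) := by
    refine ae_restrict_of_ae ?_
    have h0 : volume ({0} : Set (Fin 3 → ℝ)) = 0 := measure_singleton 0
    simpa only [mem_singleton_iff] using measure_eq_zero_iff_ae_notMem.1 h0
  filter_upwards [h1, h2] with q hq1 hq2 using ⟨hq1, hq2⟩

/-- **The box integral converges**: `∫_{|q_μ|≤π} dq/(Δ¹(q) + ξ²) → ∫_{|q_μ|≤π} dq/Δ¹(q)` as `ξ → 0⁺` (`d = 3`; dominated convergence with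
the integrable majorant `1/Δ¹`, the origin being Lebesgue-null). [cite: Balaban1983Higgs3, (3.21) p.438] -/
theorem tendsto_boxIntegral_three :
    Tendsto (fun ξ : ℝ => ∫ q in bzBox 3 1, 1 / (lapSymbol 3 1 q + ξ ^ 2)) (𝓝[>] 0)
      (𝓝 (∫ q in bzBox 3 1, (lapSymbol 3 1 q)⁻¹)) := by
  have hae := ae_mem_bzBox_ne_zero
  refine tendsto_integral_filter_of_dominated_convergence (fun q => (lapSymbol 3 1 q)⁻¹) ?_ ?_
    integrableOn_inv_lapSymbol ?_
  · refine Eventually.of_forall fun ξ => ?_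
    exact (((measurable_lapSymbol 3 1).add_const (ξ ^ 2)).const_div 1).aestronglyMeasurable
  · refine Eventually.of_forall fun ξ => ?_
    filter_upwards [hae] with q hq
    have hL := lapSymbol_pos hq.1 hq.2
    rw [Real.norm_of_nonneg (by positivity), one_div]
    exact inv_anti₀ hL (le_add_of_nonneg_right (sq_nonneg ξ))
  · filter_upwards [hae] with q hq
    exact tendsto_inv_add_sq (lapSymbol_pos hq.1 hq.2)

/-- **p. 438 [PDF 28], PROVED for the free propagator in d = 3 — "ηG_k(x,x) is convergent to some finite constant as η → 0"**:
`ξ·C^ξ(0) → (2π)^{−3}∫_{|q_μ|≤π} dq/Δ¹(q)` as `ξ → 0⁺`, `Δ¹(q) = Σ_μ(2 − 2cos q_μ)`. [cite: Balaban1983Higgs3, (3.21) p.438] -/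
theorem tendsto_xi_mul_Cxi_zero_three :
    Tendsto (fun ξ : ℝ => ξ * Cxi 3 ξ 0) (𝓝[>] 0)
      (𝓝 ((2 * Real.pi)⁻¹ ^ 3 * ∫ q in bzBox 3 1, (lapSymbol 3 1 q)⁻¹)) := by
  have hev : (fun ξ : ℝ => (2 * Real.pi)⁻¹ ^ 3 * ∫ q in bzBox 3 1, 1 / (lapSymbol 3 1 q + ξ ^ 2)) =ᶠ[𝓝[>] 0]
      fun ξ => ξ * Cxi 3 ξ 0 := by
    filter_upwards [self_mem_nhdsWithin] with ξ hξ
    exact (xi_mul_Cxi_zero_eq hξ).symm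
  exact (tendsto_boxIntegral_three.const_mul _).congr' hev

/-- **p. 438, the printed shape** (*"convergent to some finite constant"*), d = 3: there is a real constant `K` with `ξ·C^ξ(0) → K` as
`ξ → 0⁺`. [cite: Balaban1983Higgs3, (3.21) p.438] -/
theorem exists_tendsto_xi_mul_Cxi_zero_three :
    ∃ K : ℝ, Tendsto (fun ξ : ℝ => ξ * Cxi 3 ξ 0) (𝓝[>] 0) (𝓝 K) :=
  ⟨_, tendsto_xi_mul_Cxi_zero_three⟩

/-- **The limit constant is a genuine finite positive number**: `1/12 ≤ (2π)^{−3}∫_{|q_μ|≤π} dq/Δ¹(q) ≤ 3(π+1)/(4π)` (lower: `Δ¹ ≤ 12`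
on the box of volume `(2π)³`; upper: `C^ξ(0) ≤ (3(π+1)/(4π))ξ^{−1}`, r15's `B3CxiTadpole.Cxi_zero_le_three`, and the limit).
[cite: Balaban1983Higgs3, (3.21) p.438] -/
theorem tadpoleConst_mem_Icc :
    (2 * Real.pi)⁻¹ ^ 3 * ∫ q in bzBox 3 1, (lapSymbol 3 1 q)⁻¹ ∈ Icc (1 / 12 : ℝ) (3 * (Real.pi + 1) / (4 * Real.pi)) := by
  refine ⟨?_, le_of_tendsto tendsto_xi_mul_Cxi_zero_three ?_⟩
  · -- ∫_{box} 1/12 ≤ ∫_{box} 1/Δ¹, and ∫_{box} 1/12 = (2π)³/12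
    have hvol : volume.real (bzBox 3 1) = (2 * Real.pi) ^ 3 := by
      rw [measureReal_def, volume_bzBox_one, ← ENNReal.ofReal_pow (by positivity), ENNReal.toReal_ofReal (by positivity)]
    have hfin : volume (bzBox 3 1) < ⊤ := by rw [volume_bzBox_one]; exact ENNReal.pow_lt_top ENNReal.ofReal_lt_top
    have hconst : IntegrableOn (fun _ : Fin 3 → ℝ => (1 / 12 : ℝ)) (bzBox 3 1) volume := integrableOn_const hfin.ne
    have hle : ∫ _ in bzBox 3 1, (1 / 12 : ℝ) ≤ ∫ q in bzBox 3 1, (lapSymbol 3 1 q)⁻¹ := by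
      refine setIntegral_mono_ae_restrict hconst integrableOn_inv_lapSymbol ?_
      filter_upwards [ae_mem_bzBox_ne_zero] with q hq
      have hL := lapSymbol_pos hq.1 hq.2
      have hL12 : lapSymbol 3 1 q ≤ 12 := (lapSymbol_one_le q).trans (by norm_num)
      rw [one_div]
      exact inv_anti₀ hL hL12
    rw [setIntegral_const, hvol, smul_eq_mul] at hle
    have hπ : 0 < (2 * Real.pi)⁻¹ ^ 3 := by positivity
    calc (1 / 12 : ℝ) = (2 * Real.pi)⁻¹ ^ 3 * ((2 * Real.pi) ^ 3 * (1 / 12)) := by field_simp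
      _ ≤ (2 * Real.pi)⁻¹ ^ 3 * ∫ q in bzBox 3 1, (lapSymbol 3 1 q)⁻¹ := mul_le_mul_of_nonneg_left hle hπ.le
  · filter_upwards [self_mem_nhdsWithin] with ξ hξ
    have hξ' : 0 < ξ := hξ
    calc ξ * Cxi 3 ξ 0 ≤ ξ * (3 * (Real.pi + 1) / (4 * Real.pi) * ξ⁻¹) :=
          mul_le_mul_of_nonneg_left (Cxi_zero_le_three hξ') hξ'.le
      _ = 3 * (Real.pi + 1) / (4 * Real.pi) := by field_simp

end Three

/-! ## 3. d = 2: ξ·C^ξ(0) → 0 -/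

section Two

/-- **p. 438 [PDF 28], d = 2 — the finite constant is `0`**: `ξ·C^ξ(0) → 0` as `ξ → 0⁺` (from `0 ≤ C^ξ(0) ≤ A + ½log ξ^{−1}` for
`0 < ξ ≤ 1`, r15's `B3CxiTadpole.Cxi_zero_le_two_log`, and `ξ log ξ → 0`). [cite: Balaban1983Higgs3, (3.21) p.438] -/
theorem tendsto_xi_mul_Cxi_zero_two : Tendsto (fun ξ : ℝ => ξ * Cxi 2 ξ 0) (𝓝[>] 0) (𝓝 0) := by
  set A : ℝ := 1 / 4 * Real.log (1 + 4 * (Real.pi + 1) ^ 2 / Real.pi ^ 2) with hA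
  have hu : Tendsto (fun ξ : ℝ => ξ * A - 1 / 2 * (Real.log ξ * ξ)) (𝓝[>] 0) (𝓝 (0 * A - 1 / 2 * 0)) := by
    have h1 : Tendsto (fun ξ : ℝ => ξ * A) (𝓝[>] 0) (𝓝 (0 * A)) :=
      (tendsto_id.mul_const A).mono_left nhdsWithin_le_nhds
    have h2 : Tendsto (fun ξ : ℝ => Real.log ξ * ξ) (𝓝[>] 0) (𝓝 0) := by
      simpa only [Real.rpow_one] using tendsto_log_mul_rpow_nhdsGT_zero zero_lt_one
    exact h1.sub (h2.const_mul (1 / 2))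
  rw [zero_mul, mul_zero, sub_zero] at hu
  refine tendsto_of_tendsto_of_tendsto_of_le_of_le' tendsto_const_nhds hu ?_ ?_
  · filter_upwards [self_mem_nhdsWithin] with ξ hξ
    have hξ' : 0 < ξ := hξ
    exact mul_nonneg hξ'.le (Cxi_nonneg hξ' 0)
  · filter_upwards [Ioo_mem_nhdsGT (zero_lt_one' ℝ)] with ξ hξ
    calc ξ * Cxi 2 ξ 0 ≤ ξ * (A + 1 / 2 * Real.log ξ⁻¹) := mul_le_mul_of_nonneg_left (Cxi_zero_le_two_log hξ.1 hξ.2.le) hξ.1.le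
      _ = ξ * A - 1 / 2 * (Real.log ξ * ξ) := by rw [Real.log_inv]; ring

/-- **p. 438, the printed shape, d = 2**: there is a real constant `K` (`= 0`) with `ξ·C^ξ(0) → K` as `ξ → 0⁺`.
[cite: Balaban1983Higgs3, (3.21) p.438] -/
theorem exists_tendsto_xi_mul_Cxi_zero_two : ∃ K : ℝ, Tendsto (fun ξ : ℝ => ξ * Cxi 2 ξ 0) (𝓝[>] 0) (𝓝 K) :=
  ⟨0, tendsto_xi_mul_Cxi_zero_two⟩

end Two

end

end Literature.MathematicalPhysics.QuantumFieldTheory.Balaban1983to89.B3CxiTadpoleLimit
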